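import Literature.NumberTheory.EllipticCurves.DegreeConjectureAbc
import Literature.NumberTheory.EllipticCurves.SilvermanHeightCovolumeProofs
import Literature.NumberTheory.EllipticCurves.SzpiroOfAbcProofs
import Literature.NumberTheory.DiophantineGeometry.MinimalDiscriminantNormProofs
import Literature.NumberTheory.DiophantineGeometry.AbcSixteenReduction
import HarnessLib
-- buildfix (bf1-g32) B32-10: comment-only touch to re-dispatch the lane build (prune victim: source 08-16, hub olean removed 22:46Z 08-28; deepest olean-less link under the ACTIVE route RibetTakahashiSplit (Theses edited 05:50Z); its closes-users/provers answer remote:stale:N:unbuilt); declarations byte-identical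

/-!
# Route RibetTakahashiSplit — crux `WeightedSzpiroBound` (stmt-ABC-3272),
  line `two-adic-eisenstein-anchor`: stub `stub_slackTransfer`

The registered stub 3 of the line: **Murty's theorem "the degree conjecture for Frey curves
implies abc" re-run with `|Δ_min|^ε` SLACK in the degree bound.** Relative to the Petersson lower
bound `(f,f) ≫_ε N^{1−ε}` (named fact `murty_petersson_newform_lower_bound`, first hypothesis;
Hoffstein–Lockhart 1994 / Murty 1999), the slack degree bound

> for every `ε > 0` some `C` with, on every Frey curve `E_{a,b} : y² = x(x − a)(x + b)` at level
> `N = N_E`, a parametrisation datum `D` with `deg D ≤ C · (D.c)² · N^{2+ε} · |Δ_min(E_{a,b})|^ε`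

implies the strong abc-conjecture in the `≤`-form of Bombieri–Gubler 12.2.2.  The slack-free
statement is `Literature.NumberTheory.EllipticCurves.abcLe_of_freyDegreeBound` (Frey 1989;
Mai–Murty 1994; M. R. Murty 1999, Thm. 1; Pasten arXiv:1705.09251 §3), and the proof is that
proof with the exponents re-cut:

* Zagier's identity `4π² c² (f,f) = deg · covol(Λ_D)` (PROVED, inside
  `covolume_neronLattice_ge_of_deg_le`) with the constant `C₁ := max(C,1) · |Δ_min|^δ` and the
  Petersson bound give `covol(Λ_D) ≥ κ · |Δ_min|^{−δ} · N^{−(1+2δ)}`, `κ = 4π²c₂ / max(C,1)`.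
* Serre's normalisation (`exists_arrangement`, available when `16 ∣ abc`; the passage to all
  triples is the elementary `DiophantineGeometry.abcLe_of_abcLe_sixteen_dvd`) gives the global
  minimal equation (12.18) `W₀ = freyIntModel₂ A B`, reached from `E_{A,B}` with `u = 2`, so
  `covol(Λ_Néron(W₀)) = 4 covol(Λ_D) ≥ covol(Λ_D)`; and `|Δ_min(E_{A,B})| = |Δ(W₀)|`
  (`minimalDiscriminantNorm_smul_rat`, `minimalDiscriminantNorm_eq_natAbs_holds`).
* Silverman's covolume inequality (PROVED, `silverman1986_discriminant_c4_covolume_holds`):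
  `H := max(|Δ(W₀)|, |c₄(W₀)|³) ≤ A covol(Λ_Néron)^{−(6+δ)} ≤ A κ^{−(6+δ)} N^{(1+2δ)(6+δ)} |Δ_min|^{δ(6+δ)}`,
  and `|Δ_min| ≤ H`, so `H^{1−δ(6+δ)} ≤ A κ^{−(6+δ)} N^{(1+2δ)(6+δ)}` — the only new step
  (`SlackTransfer.le_rpow_of_le_mul_rpow`, `SlackTransfer.le_of_covolume_estimates`).
* `c² ≤ 2|c₄(W₀)|` and `N ∣ rad(abc)` give `c⁶ ≤ 8 K_δ rad(abc)^{e(δ)}` with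
  `e(δ) = (1+2δ)(6+δ)/(1−δ(6+δ)) ≤ 6(1+ε)` for `δ = min(1/100, ε/20)`.

Everything used is PROVED in the tree except the first hypothesis (Petersson), which is a
hypothesis of the registered signature.  Lands `--supports stmt-ABC-3272`.

## References

* M. R. Murty, *Bounds for congruence primes*, Proc. Sympos. Pure Math. 66.1 (1999), Thm. 1.
  [MurtyCongruencePrimes1999]
* H. Pasten, *Shimura curves and the abc conjecture*, arXiv:1705.09251 = JNT 254 (2024), §3.
  [PastenShimura2024]
* G. Frey, in: Modular Forms and Fermat's Last Theorem (1997), §3, Cor. 3.1. [Frey1997Ternary]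
* J. H. Silverman, *Heights and elliptic curves*, in: Arithmetic Geometry (1986), Cor. 2.3.
  [Silverman1986]
* E. Bombieri, W. Gubler, *Heights in Diophantine Geometry* (2006), Conj. 12.2.2, Ex. 12.5.10.
  [BombieriGubler2006]
-/

-- `Summit.<Summit>.<Problem>` is the mandated summit-side namespace (CONVENTIONS §2); for the
-- single-conjunct summit `ABC` the two coincide, so the duplicate `ABC.ABC` is deliberate.
set_option linter.dupNamespace false

noncomputable section

namespace Summit.ABC.ABC.Theorems.TwoAdicEisensteinAnchor

open IsDedekindDomain WeierstrassCurve UniqueFactorizationMonoid CongruenceSubgroup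
open Literature.NumberTheory
open Literature.NumberTheory.EllipticCurves
open Literature.NumberTheory.EllipticCurves.ModularForms

/-! ## Real-arithmetic bookkeeping -/

/-- Exponent bookkeeping: for `0 < δ ≤ 1/100` with `20 δ ≤ ε`,
`(1 + 2δ)(6 + δ) / (1 − δ(6 + δ)) ≤ 6 (1 + ε)`. [folklore] -/
theorem SlackTransfer.exponent_le {δ ε : ℝ} (hδ : 0 < δ) (hδ1 : δ ≤ 1 / 100)
    (hδε : 20 * δ ≤ ε) :
    (1 + 2 * δ) * (6 + δ) / (1 - δ * (6 + δ)) ≤ 6 * (1 + ε) := by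
  have hθ : 0 < 1 - δ * (6 + δ) := by nlinarith
  rw [div_le_iff₀ hθ]
  nlinarith [mul_pos hδ hδ, mul_nonneg hδ.le (by linarith : (0 : ℝ) ≤ ε)]

/-- Self-improvement of a sub-linear bound: `0 < H ≤ K · H^θ` with `θ < 1` gives
`H ≤ K^{1/(1−θ)}` (divide by `H^θ` and take the `(1 − θ)`-th root). [folklore] -/
theorem SlackTransfer.le_rpow_of_le_mul_rpow {H K θ : ℝ} (hH : 0 < H) (hθ : θ < 1)
    (h : H ≤ K * H ^ θ) : H ≤ K ^ (1 / (1 - θ)) := by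
  have hHθ : 0 < H ^ θ := Real.rpow_pos_of_pos hH θ
  have h1 : H ^ (1 - θ) ≤ K := by
    rw [Real.rpow_sub hH, Real.rpow_one, div_le_iff₀ hHθ]
    exact h
  have h1θ : 0 < 1 - θ := sub_pos.mpr hθ
  have h2 := Real.rpow_le_rpow (Real.rpow_nonneg hH.le _) h1 (one_div_pos.mpr h1θ).le
  rwa [← Real.rpow_mul hH.le, mul_one_div_cancel h1θ.ne', Real.rpow_one] at h2

/-- **Real-arithmetic core of the slack transfer.** If `Δ ≤ H ≤ A · cov'^{−(6+δ)}`,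
`cov ≤ cov'`, `κ Δ^{−δ} N^{−(1+2δ)} ≤ cov` (all quantities positive, `A ≥ 0`) and
`δ(6 + δ) < 1`, then `H ≤ (A κ^{−(6+δ)})^{1/(1−δ(6+δ))} · N^{(1+2δ)(6+δ)/(1−δ(6+δ))}`:
indeed `H ≤ A κ^{−(6+δ)} N^{(1+2δ)(6+δ)} Δ^{δ(6+δ)} ≤ A κ^{−(6+δ)} N^{(1+2δ)(6+δ)} H^{δ(6+δ)}`.
[folklore] -/
theorem SlackTransfer.le_of_covolume_estimates {H Δ A cov cov' κ N δ : ℝ} (hδ : 0 < δ)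
    (hθ : δ * (6 + δ) < 1) (hA : 0 ≤ A) (hκ : 0 < κ) (hN : 0 < N) (hcov : 0 < cov)
    (hΔ : 0 < Δ) (hΔH : Δ ≤ H) (hH : H ≤ A * cov' ^ (-(6 + δ))) (hcc : cov ≤ cov')
    (hlow : κ * Δ ^ (-δ) * N ^ (-(1 + 2 * δ)) ≤ cov) :
    H ≤ (A * κ ^ (-(6 + δ))) ^ (1 / (1 - δ * (6 + δ))) *
      N ^ ((1 + 2 * δ) * (6 + δ) / (1 - δ * (6 + δ))) := by
  have hexp : -(6 + δ) ≤ 0 := by linarith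
  have hlow0 : 0 < κ * Δ ^ (-δ) * N ^ (-(1 + 2 * δ)) :=
    mul_pos (mul_pos hκ (Real.rpow_pos_of_pos hΔ _)) (Real.rpow_pos_of_pos hN _)
  have h1 : cov' ^ (-(6 + δ)) ≤ cov ^ (-(6 + δ)) := Real.rpow_le_rpow_of_nonpos hcov hcc hexp
  have h2 : cov ^ (-(6 + δ)) ≤ (κ * Δ ^ (-δ) * N ^ (-(1 + 2 * δ))) ^ (-(6 + δ)) :=
    Real.rpow_le_rpow_of_nonpos hlow0 hlow hexp
  have h3 : (κ * Δ ^ (-δ) * N ^ (-(1 + 2 * δ))) ^ (-(6 + δ)) =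
      κ ^ (-(6 + δ)) * N ^ ((1 + 2 * δ) * (6 + δ)) * Δ ^ (δ * (6 + δ)) := by
    rw [Real.mul_rpow (mul_pos hκ (Real.rpow_pos_of_pos hΔ _)).le (Real.rpow_nonneg hN.le _),
      Real.mul_rpow hκ.le (Real.rpow_nonneg hΔ.le _), ← Real.rpow_mul hΔ.le,
      ← Real.rpow_mul hN.le]
    have e1 : -δ * -(6 + δ) = δ * (6 + δ) := by ring
    have e2 : -(1 + 2 * δ) * -(6 + δ) = (1 + 2 * δ) * (6 + δ) := by ring
    rw [e1, e2]; ring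
  have hH0 : 0 < H := hΔ.trans_le hΔH
  have h4 : Δ ^ (δ * (6 + δ)) ≤ H ^ (δ * (6 + δ)) := Real.rpow_le_rpow hΔ.le hΔH (by positivity)
  have hκe : 0 ≤ κ ^ (-(6 + δ)) * N ^ ((1 + 2 * δ) * (6 + δ)) :=
    mul_nonneg (Real.rpow_nonneg hκ.le _) (Real.rpow_nonneg hN.le _)
  -- `H ≤ (A κ^{-(6+δ)} N^{(1+2δ)(6+δ)}) · H^{δ(6+δ)}`
  have h5 : H ≤ A * κ ^ (-(6 + δ)) * N ^ ((1 + 2 * δ) * (6 + δ)) * H ^ (δ * (6 + δ)) := by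
    calc H ≤ A * cov' ^ (-(6 + δ)) := hH
      _ ≤ A * (κ ^ (-(6 + δ)) * N ^ ((1 + 2 * δ) * (6 + δ)) * Δ ^ (δ * (6 + δ))) :=
          mul_le_mul_of_nonneg_left ((h1.trans h2).trans_eq h3) hA
      _ ≤ A * (κ ^ (-(6 + δ)) * N ^ ((1 + 2 * δ) * (6 + δ)) * H ^ (δ * (6 + δ))) :=
          mul_le_mul_of_nonneg_left (mul_le_mul_of_nonneg_left h4 hκe) hA
      _ = _ := by ring
  have h6 := SlackTransfer.le_rpow_of_le_mul_rpow hH0 hθ h5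
  have hK0 : 0 ≤ A * κ ^ (-(6 + δ)) := mul_nonneg hA (Real.rpow_nonneg hκ.le _)
  rwa [Real.mul_rpow hK0 (Real.rpow_nonneg hN.le _), ← Real.rpow_mul hN.le, mul_one_div] at h6

/-- From `H` to `c`: `c² ≤ 2 c₄'`, `c₄'³ ≤ H ≤ K₁ N^e` (`K₁, e ≥ 0`) and `0 < N ≤ R` give
`c⁶ ≤ 8 K₁ R^e`. [folklore] -/
theorem SlackTransfer.pow_six_le {c c₄ H K₁ N R e : ℝ} (hK₁ : 0 ≤ K₁) (hN : 0 < N) (he : 0 ≤ e)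
    (hc : c ^ 2 ≤ 2 * c₄) (hc₄ : c₄ ^ 3 ≤ H) (hH : H ≤ K₁ * N ^ e) (hNR : N ≤ R) :
    c ^ 6 ≤ 8 * K₁ * R ^ e := by
  have h4 : N ^ e ≤ R ^ e := Real.rpow_le_rpow hN.le hNR he
  calc c ^ 6 = (c ^ 2) ^ 3 := by ring
    _ ≤ (2 * c₄) ^ 3 := pow_le_pow_left₀ (sq_nonneg c) hc 3
    _ = 8 * c₄ ^ 3 := by ring
    _ ≤ 8 * (K₁ * N ^ e) := by linarith
    _ ≤ 8 * (K₁ * R ^ e) := mul_le_mul_of_nonneg_left (mul_le_mul_of_nonneg_left h4 hK₁) (by norm_num)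
    _ = _ := by ring

/-! ## One Frey pair: slack degree bound ⟹ covolume bound ⟹ Silverman for the minimal model -/

/-- **The estimates for one Frey pair, with slack** (the tree's `estimates_of_frey_pair` with one
extra factor `|Δ_min|^δ` in the degree bound, keeping the full `max(|Δ|, |c₄|³)` of Silverman and
the identification `|Δ_min(E_{A,B})| = |Δ(W₀)|`).  Let `A, B` be coprime with `AB(A+B) ≠ 0`, let
`W₀ / ℤ` be an equation of the Frey curve `E_{A,B} : y² = x(x − A)(x + B)` minimal at every prime,
reached from it by the change of variables `C` with `|u| ≥ 1`, and assume: the slack degree bound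
`deg ≤ C₀ c² N^{2+δ} |Δ_min|^δ` for some datum of every Frey curve at level `N = N_E`, the
Petersson bound `c₂ N^{1−δ} ≤ (f,f)`, and Silverman's `max(|Δ|,|c₄|³) ≤ A₀ covol(Λ_Néron)^{−(6+δ)}`.
Then with `cov` the covolume of the datum's lattice and `cov' = |u|² cov ≥ cov` that of the Néron
lattice of `W₀`: `max(|Δ(W₀)|, |c₄(W₀)|³) ≤ max(A₀,1) cov'^{−(6+δ)}`,
`(4π²c₂/max(C₀,1)) |Δ_min|^{−δ} N^{−(1+2δ)} ≤ cov` (Zagier, `covolume_neronLattice_ge_of_deg_le`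
with `C₁ = max(C₀,1)|Δ_min|^δ`), and `|Δ_min(E_{A,B})| = |Δ(W₀)|` (`minimalDiscriminantNorm_smul_rat`,
`minimalDiscriminantNorm_eq_natAbs_holds`).  Murty 1999, proof of Thm. 1, as reviewed in Pasten
arXiv:1705.09251 §3. [cite: PastenShimura2024, §3] -/
theorem SlackTransfer.estimates_of_frey_pair {A B : ℤ} (hAB : IsCoprime A B)
    (h0 : A * B * (A + B) ≠ 0) (W₀ : WeierstrassCurve ℤ)
    (hmin : ∀ v : HeightOneSpectrum ℤ, (W₀.baseChange ℚ).IsMinimalAt v)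
    (hell : (W₀.baseChange ℚ).IsElliptic) (C : VariableChange ℚ)
    (hCW : C • freyCurve A B = W₀.baseChange ℚ) (hu : 1 ≤ ‖((C.u : ℚ) : ℂ)‖)
    {C₀ c₂ A₀ δ : ℝ}
    (hC₀ : ∀ a b : ℤ, IsCoprime a b → a * b * (a + b) ≠ 0 →
      ∀ (N : ℕ) [NeZero N], (freyCurve a b).conductorNorm ℤ = N →
        ∃ D : ModularParametrizationData (freyCurve a b) N,
          (D.deg : ℝ) ≤ C₀ * (D.c : ℝ) ^ 2 * (N : ℝ) ^ (2 + δ) *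
            (((freyCurve a b).minimalDiscriminantNorm ℤ : ℕ) : ℝ) ^ δ)
    (hPc : ∀ (N : ℕ) [NeZero N] (W : WeierstrassCurve ℚ) [W.IsElliptic]
      (f : CuspForm (Gamma0 N) 2), IsNewformOf W f →
        c₂ * (N : ℝ) ^ (1 - δ) ≤ (peterssonProduct (Gamma0 N) 2 f f).re)
    (hA₀ : ∀ (W : WeierstrassCurve ℚ) [W.IsElliptic] [W.IsGloballyMinimal] (L : PeriodPair),
      IsNeronLatticeOf (W.baseChange ℂ) L →
        ((max |W.Δ| (|W.c₄| ^ 3) : ℚ) : ℝ) ≤ A₀ * ZLattice.covolume L.lattice ^ (-(6 + δ))) :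
    ∃ cov cov' : ℝ, 0 < cov ∧
      max |(W₀.Δ : ℝ)| (|(W₀.c₄ : ℝ)| ^ 3) ≤ max A₀ 1 * cov' ^ (-(6 + δ)) ∧ cov ≤ cov' ∧
      4 * Real.pi ^ 2 * c₂ / max C₀ 1 *
          (((freyCurve A B).minimalDiscriminantNorm ℤ : ℕ) : ℝ) ^ (-δ) *
        (((freyCurve A B).conductorNorm ℤ : ℕ) : ℝ) ^ (-(1 + 2 * δ)) ≤ cov ∧
      (((freyCurve A B).minimalDiscriminantNorm ℤ : ℕ) : ℝ) = |(W₀.Δ : ℝ)| := by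
  haveI := isElliptic_freyCurve h0
  haveI := hell
  haveI : (W₀.baseChange ℚ).IsGloballyMinimal := isGloballyMinimal_of_forall_isMinimalAt_int _ hmin
  set N : ℕ := (freyCurve A B).conductorNorm ℤ with hNdef
  have hN0 : 0 < N := conductorNorm_pos_holds (freyCurve A B)
  haveI : NeZero N := ⟨hN0.ne'⟩
  obtain ⟨D, hD⟩ := hC₀ A B hAB h0 N hNdef.symm
  -- `|Δ_min| ≥ 1`
  set Δm : ℝ := (((freyCurve A B).minimalDiscriminantNorm ℤ : ℕ) : ℝ) with hΔmdef
  have hΔm1 : 1 ≤ Δm := by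
    rw [hΔmdef]
    exact Nat.one_le_cast.mpr (WeierstrassCurve.minimalDiscriminantNorm_pos_holds (freyCurve A B))
  have hΔm0 : 0 < Δm := one_pos.trans_le hΔm1
  -- the degree bound with `C₁ = max C₀ 1 * Δm ^ δ > 0`
  have hC₁ : 0 < max C₀ 1 * Δm ^ δ :=
    mul_pos (one_pos.trans_le (le_max_right _ _)) (Real.rpow_pos_of_pos hΔm0 _)
  have hxy : 0 ≤ (D.c : ℝ) ^ 2 * (N : ℝ) ^ (2 + δ) * Δm ^ δ := by positivity
  have hD' : (D.deg : ℝ) ≤ max C₀ 1 * Δm ^ δ * (D.c : ℝ) ^ 2 * (N : ℝ) ^ (2 + δ) := by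
    calc (D.deg : ℝ) ≤ C₀ * (D.c : ℝ) ^ 2 * (N : ℝ) ^ (2 + δ) * Δm ^ δ := hD
      _ = C₀ * ((D.c : ℝ) ^ 2 * (N : ℝ) ^ (2 + δ) * Δm ^ δ) := by ring
      _ ≤ max C₀ 1 * ((D.c : ℝ) ^ 2 * (N : ℝ) ^ (2 + δ) * Δm ^ δ) :=
          mul_le_mul_of_nonneg_right (le_max_left _ _) hxy
      _ = _ := by ring
  have hPD := hPc N (freyCurve A B) D.f D.isNewformOf
  have hlow := covolume_neronLattice_ge_of_deg_le D hC₁ hD' hPD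
  -- the Néron lattice of the minimal model `W₀ ⊗ ℚ = C • E_{A,B}` is `u · Λ`
  have hL : IsNeronLatticeOf ((freyCurve A B).baseChange ℂ) D.L := D.isNeronLattice
  set Cc : VariableChange ℂ := C.map (algebraMap ℚ ℂ) with hCc
  have hLs := hL.smul Cc
  have hmap : (C • freyCurve A B).baseChange ℂ = Cc • (freyCurve A B).baseChange ℂ := by
    simp only [hCc, WeierstrassCurve.baseChange, WeierstrassCurve.map_variableChange]
  rw [← hmap, hCW] at hLs
  have hSW := hA₀ (W₀.baseChange ℚ) _ hLs
  set L' : PeriodPair := D.L.mulLeft ((Cc.u : ℂˣ) : ℂ) Cc.u.ne_zero with hL'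
  have hcov'0 : 0 < ZLattice.covolume L'.lattice := ZLattice.covolume_pos _ _
  -- the invariants of `W₀ ⊗ ℚ` are those of `W₀`
  have hΔW : (W₀.baseChange ℚ).Δ = (W₀.Δ : ℚ) := by
    simp [WeierstrassCurve.baseChange, WeierstrassCurve.map_Δ]
  have hc₄W : (W₀.baseChange ℚ).c₄ = (W₀.c₄ : ℚ) := by
    simp [WeierstrassCurve.baseChange, WeierstrassCurve.map_c₄]
  refine ⟨ZLattice.covolume D.L.lattice, ZLattice.covolume L'.lattice, ZLattice.covolume_pos _ _,
    ?_, ?_, ?_, ?_⟩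
  · -- Silverman: `max(|Δ|, |c₄|³) ≤ A₀ covol'^{-(6+δ)} ≤ max(A₀,1) covol'^{-(6+δ)}`
    have e1 : max |(W₀.Δ : ℝ)| (|(W₀.c₄ : ℝ)| ^ 3) =
        ((max |(W₀.baseChange ℚ).Δ| (|(W₀.baseChange ℚ).c₄| ^ 3) : ℚ) : ℝ) := by
      rw [hΔW, hc₄W]; push_cast; rfl
    have hpos : 0 ≤ ZLattice.covolume L'.lattice ^ (-(6 + δ)) := Real.rpow_nonneg hcov'0.le _
    rw [e1]
    exact hSW.trans (mul_le_mul_of_nonneg_right (le_max_left A₀ 1) hpos)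
  · -- `covol ≤ |u|² covol = covol'`
    rw [hL', PeriodPair.covolume_mulLeft_lattice]
    have hnorm : ((Cc.u : ℂˣ) : ℂ) = ((C.u : ℚ) : ℂ) := by
      simp [hCc, WeierstrassCurve.VariableChange.map_u]
    rw [hnorm]
    have hcov0 : 0 ≤ ZLattice.covolume D.L.lattice := (ZLattice.covolume_pos _ _).le
    have hu2 : 1 ≤ ‖((C.u : ℚ) : ℂ)‖ ^ 2 := one_le_pow₀ hu
    calc ZLattice.covolume D.L.lattice = 1 * ZLattice.covolume D.L.lattice := (one_mul _).symm
      _ ≤ _ := mul_le_mul_of_nonneg_right hu2 hcov0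
  · -- the covolume bound, with `1/(max C₀ 1 · Δm^δ) = Δm^{-δ}/max C₀ 1`
    have e2 : 4 * Real.pi ^ 2 * c₂ / max C₀ 1 * Δm ^ (-δ) =
        4 * Real.pi ^ 2 * c₂ / (max C₀ 1 * Δm ^ δ) := by
      rw [Real.rpow_neg hΔm0.le]
      field_simp
    rw [e2]
    exact hlow
  · -- `|Δ_min(E_{A,B})| = |Δ_min(W₀ ⊗ ℚ)| = |Δ(W₀)|`
    have hΔ0 : W₀.Δ ≠ 0 := by
      have h := (W₀.baseChange ℚ).isUnit_Δ.ne_zero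
      rw [hΔW] at h
      exact_mod_cast h
    have hnat : (freyCurve A B).minimalDiscriminantNorm ℤ = W₀.Δ.natAbs := by
      rw [← WeierstrassCurve.minimalDiscriminantNorm_smul_rat (freyCurve A B) C, hCW]
      exact WeierstrassCurve.minimalDiscriminantNorm_eq_natAbs_holds W₀ hΔ0 hmin
    rw [hΔmdef, hnat, Nat.cast_natAbs, Int.cast_abs]

/-! ## The stub -/

/-- **Stub 3 of line `two-adic-eisenstein-anchor` (crux `WeightedSzpiroBound`, stmt-ABC-3272) —
Murty's "degree conjecture ⟹ abc" WITH `|Δ_min|^ε` SLACK.** Relative to the Petersson lower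
bound `(f,f) ≫_ε N^{1−ε}` (named fact `murty_petersson_newform_lower_bound`, first hypothesis;
Silverman's covolume inequality is PROVED in the tree, `silverman1986_discriminant_c4_covolume_holds`):
the SLACK degree bound — for every `ε > 0` some `C` with
`∃ D, deg D ≤ C · (D.c)² · N^{2+ε} · |Δ_min(E_{a,b})|^ε` on every Frey curve at level `N = N_E` —
implies the `≤`-form of the strong abc-conjecture (Bombieri–Gubler 12.2.2).  Proof =
`abcLe_of_freyDegreeBound` re-run with one more factor: with `δ = min(1/100, ε/20)`, Zagier +
Petersson give `covol(Λ_D) ≥ κ N^{−1−2δ}|Δ_min|^{−δ}`; for `16 ∣ abc` the global minimal Frey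
equation (12.18) (`exists_arrangement`, `freyIntModel₂`, `u = 2`) has
`covol(Λ_Néron) = u² covol(Λ_D)`; Silverman gives
`H := max(|Δ_min|,|c₄|³) ≤ A κ^{−(6+δ)} N^{(1+2δ)(6+δ)} H^{δ(6+δ)}` (as `|Δ_min| ≤ H`), so
`H ≤ K_δ N^{(1+2δ)(6+δ)/(1−δ(6+δ))}`; with `c² ≤ 2|c₄|` and `N ∣ rad(abc)`,
`c ≤ M_ε rad^{1+ε}`; all triples by `DiophantineGeometry.abcLe_of_abcLe_sixteen_dvd`.
(Frey 1989; Mai–Murty 1994; Murty 1999 Thm. 1; Pasten arXiv:1705.09251 §3.)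
[cite: MurtyCongruencePrimes1999, Thm. 1 (degree conjecture implies abc) via PastenShimura2024 §3 Rem. 3.3] -/
theorem stub_slackTransfer :
    Literature.NumberTheory.EllipticCurves.ModularForms.murty_petersson_newform_lower_bound →
    (∀ ε : ℝ, 0 < ε → ∃ C : ℝ, ∀ a b : ℤ, IsCoprime a b → a * b * (a + b) ≠ 0 →
      ∀ (N : ℕ) [NeZero N],
        (Literature.NumberTheory.EllipticCurves.freyCurve a b).conductorNorm ℤ = N →
        ∃ D : Literature.NumberTheory.EllipticCurves.ModularForms.ModularParametrizationData
            (Literature.NumberTheory.EllipticCurves.freyCurve a b) N,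
          (D.deg : ℝ) ≤ C * (D.c : ℝ) ^ 2 * (N : ℝ) ^ (2 + ε) *
            (((Literature.NumberTheory.EllipticCurves.freyCurve a b).minimalDiscriminantNorm ℤ
                : ℕ) : ℝ) ^ ε) →
    ∀ ε : ℝ, 0 < ε → ∃ C : ℝ, ∀ a b c : ℕ,
      Literature.NumberTheory.DiophantineGeometry.IsABCTriple a b c →
        (c : ℝ) ≤ C * ((Literature.NumberTheory.DiophantineGeometry.rad a b c : ℕ) : ℝ) ^ (1 + ε) := by
  intro hP hdeg
  refine DiophantineGeometry.abcLe_of_abcLe_sixteen_dvd fun ε hε ↦ ?_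
  -- parameters and constants, depending on `ε` only
  set δ : ℝ := min (1 / 100) (ε / 20) with hδdef
  have hδ : 0 < δ := lt_min (by norm_num) (by positivity)
  have hδ1 : δ ≤ 1 / 100 := min_le_left _ _
  have hδε : 20 * δ ≤ ε := by have := min_le_right (1 / 100 : ℝ) (ε / 20); linarith
  have hθ : δ * (6 + δ) < 1 := by nlinarith
  have hθ' : 0 < 1 - δ * (6 + δ) := sub_pos.mpr hθ
  obtain ⟨C₀, hC₀⟩ := hdeg δ hδ
  obtain ⟨c₂, hc₂, hPc⟩ := hP δ hδ
  obtain ⟨A₀, hA₀⟩ := silverman1986_discriminant_c4_covolume_holds δ hδ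
  have hA : (0 : ℝ) ≤ max A₀ 1 := zero_le_one.trans (le_max_right _ _)
  set κ : ℝ := 4 * Real.pi ^ 2 * c₂ / max C₀ 1 with hκdef
  have hκ : 0 < κ := div_pos (by positivity) (one_pos.trans_le (le_max_right _ _))
  set e : ℝ := (1 + 2 * δ) * (6 + δ) / (1 - δ * (6 + δ)) with hedef
  have he : 0 ≤ e := div_nonneg (by positivity) hθ'.le
  set K₁ : ℝ := (max A₀ 1 * κ ^ (-(6 + δ))) ^ (1 / (1 - δ * (6 + δ))) with hK₁def
  have hK₁ : 0 ≤ K₁ := Real.rpow_nonneg (mul_nonneg hA (Real.rpow_nonneg hκ.le _)) _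
  have hM : (0 : ℝ) ≤ 8 * K₁ := by positivity
  refine ⟨(8 * K₁) ^ (1 / 6 : ℝ), fun a b c h h16 ↦ ?_⟩
  have h' := h
  obtain ⟨ha, hb, habc, hcop⟩ := h'
  have hc0 : 0 < c := by omega
  have habc0 : a * b * c ≠ 0 := by positivity
  set R : ℝ := ((DiophantineGeometry.rad a b c : ℕ) : ℝ) with hRdef
  have hRpos : 0 < DiophantineGeometry.rad a b c := by
    rw [DiophantineGeometry.rad_def]; exact Nat.pos_of_ne_zero radical_ne_zero
  have hR : (1 : ℝ) ≤ R := by rw [hRdef]; exact_mod_cast hRpos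
  -- Serre's normalisation and the global minimal equation (12.18), `u = 2`
  obtain ⟨A, B, hAB, hA4, hB, hprod, hquad⟩ := exists_arrangement h h16
  have h0 : A * B * (A + B) ≠ 0 := by
    rw [← Int.natAbs_ne_zero, hprod]; exact habc0
  have h4 : 4 ∣ B - A - 1 := by
    have : B - A - 1 = B - (A + 1) := by ring
    rw [this]; exact dvd_sub (dvd_trans (by norm_num) hB) hA4
  have h16' : 16 ∣ A * B := dvd_mul_of_dvd_right hB _
  haveI := isElliptic_freyCurve h0
  set Cv : VariableChange ℚ := ⟨Units.mk0 (2 : ℚ) two_ne_zero, 0, 1, 0⟩ with hCv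
  have hCW : Cv • freyCurve A B = (freyIntModel₂ A B).baseChange ℚ :=
    smul_freyCurve_eq_baseChange_freyIntModel₂ h4 h16'
  have hu : 1 ≤ ‖((Cv.u : ℚ) : ℂ)‖ := by simp [hCv]
  obtain ⟨cov, cov', hcov, hH, hcc, hlow, hΔm⟩ := SlackTransfer.estimates_of_frey_pair hAB h0
    (freyIntModel₂ A B) (isMinimalAt_freyIntModel₂ hAB hA4 hB) (isElliptic_freyIntModel₂ h0 h4 h16')
    Cv hCW hu hC₀ hPc hA₀
  -- the conductor: `N_E = cond (12.18) ∣ rad (AB(A+B)) = rad (abc)`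
  have hcond : (freyCurve A B).conductorNorm ℤ =
      ((freyIntModel₂ A B).baseChange ℚ).conductorNorm ℤ := by
    rw [← conductorNorm_smul_rat (freyCurve A B) Cv, hCW]
  have hdvd : (freyCurve A B).conductorNorm ℤ ∣ DiophantineGeometry.rad a b c := by
    rw [hcond, DiophantineGeometry.rad_def, ← hprod]
    exact conductorNorm_freyIntModel₂_dvd hAB h0 hA4 hB
  have hNle : (((freyCurve A B).conductorNorm ℤ : ℕ) : ℝ) ≤ R := by
    rw [hRdef]; exact_mod_cast Nat.le_of_dvd hRpos hdvd
  have hNpos : (0 : ℝ) < (((freyCurve A B).conductorNorm ℤ : ℕ) : ℝ) := by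
    exact_mod_cast conductorNorm_pos_holds (freyCurve A B)
  -- `|Δ_min| ≤ H := max(|Δ(W₀)|, |c₄(W₀)|³)` and the self-improved Silverman bound
  have hΔm0 : (0 : ℝ) < (((freyCurve A B).minimalDiscriminantNorm ℤ : ℕ) : ℝ) := by
    exact_mod_cast WeierstrassCurve.minimalDiscriminantNorm_pos_holds (freyCurve A B)
  have hΔmH : (((freyCurve A B).minimalDiscriminantNorm ℤ : ℕ) : ℝ) ≤
      max |((freyIntModel₂ A B).Δ : ℝ)| (|((freyIntModel₂ A B).c₄ : ℝ)| ^ 3) :=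
    hΔm.trans_le (le_max_left _ _)
  have hHle := SlackTransfer.le_of_covolume_estimates hδ hθ hA hκ hNpos hcov hΔm0 hΔmH hH hcc hlow
  -- `c² ≤ 2 c₄'`, `c₄' = A² + AB + B² = (a² + b² + c²)/2`
  have hcc4 : (c : ℝ) ^ 2 ≤ 2 * |((freyIntModel₂ A B).c₄ : ℝ)| := by
    rw [freyIntModel₂_c₄ h4 h16']
    have hq : (0 : ℤ) ≤ A ^ 2 + A * B + B ^ 2 := by
      nlinarith [sq_nonneg (A + B), sq_nonneg A, sq_nonneg B]
    have hz : ((c : ℕ) : ℤ) ^ 2 ≤ 2 * |A ^ 2 + A * B + B ^ 2| := by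
      rw [abs_of_nonneg hq, hquad]; nlinarith [sq_nonneg (a : ℤ), sq_nonneg (b : ℤ)]
    have hzr : (((c : ℕ) : ℤ) : ℝ) ^ 2 ≤ 2 * |((A ^ 2 + A * B + B ^ 2 : ℤ) : ℝ)| := by
      exact_mod_cast hz
    simpa using hzr
  have hc₄H : |((freyIntModel₂ A B).c₄ : ℝ)| ^ 3 ≤
      max |((freyIntModel₂ A B).Δ : ℝ)| (|((freyIntModel₂ A B).c₄ : ℝ)| ^ 3) := le_max_right _ _
  -- bookkeeping
  have h6 := SlackTransfer.pow_six_le hK₁ hNpos he hcc4 hc₄H hHle hNle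
  exact le_of_pow_six_le (Nat.cast_nonneg c) hM hR (SlackTransfer.exponent_le hδ hδ1 hδε) h6

end Summit.ABC.ABC.Theorems.TwoAdicEisensteinAnchor

end
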